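import Mathlib.NumberTheory.NumberField.ClassNumber
import Mathlib.NumberTheory.NumberField.Discriminant.Defs
import Mathlib.RingTheory.Ideal.Over
import HarnessLib

/-!
# Imaginary quadratic fields with prescribed splitting at finitely many primes and class number
# prime to `3` exist (Bhargava–Varma 2016, Cor. 4 (a); Davenport–Heilbronn with local conditions)

Topic `NumberTheory/QuadraticFields`. A NAMED FACT (cite-only `def … : Prop`, nothing asserted),
the existence consequence of:

M. Bhargava, I. Varma, *The mean number of 3-torsion elements in the class groups and ideal groups
of quadratic orders*, Proc. London Math. Soc. (3) 112 (2016), 235–266, **Corollary 4** (p. 237 of the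
journal; p. 3 of arXiv:1401.5875, held as `paper:arxiv-1401.5875`), verbatim: "Suppose one restricts
to just those quadratic fields satisfying any specified set of local conditions at any finite set of
primes. Then, when these quadratic fields are ordered by their absolute discriminants: (a) The average
number of 3-torsion elements in the class groups of such imaginary quadratic fields is 2. (b) The
average number of 3-torsion elements in the class groups of such real quadratic fields is 4/3." (The
case of no local conditions is Davenport–Heilbronn 1971, Theorem 1 there; local conditions at a prime
`p` = a set `Σ_p` of étale quadratic algebras over `ℚ_p`, p. 236: "for each prime `p`, let `Σ_p` be
any set of isomorphism classes of orders in étale quadratic algebras over `ℚ_p`"; Cor. 4 is the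
maximal-order case of Thm. 3 / Thm. 8.)

**The consequence typed here.** Take the local conditions "split at every `p ∈ S`" (`L ⊗ ℚ_p ≅
ℚ_p × ℚ_p`) and "inert at every `q ∈ T`" (`L ⊗ ℚ_q` the unramified quadratic field) for disjoint
finite sets of primes `S`, `T` (any primes, `2` and `3` included — the corollary has no exceptional
primes). The family of imaginary quadratic fields with these conditions is infinite, and the number of
`3`-torsion elements of a class group is `1` or a positive power of `3`; if all but finitely many
members had class number divisible by `3` the average in (a) would be `≥ 3`, not `2`. Hence SOME
(indeed infinitely many) imaginary quadratic `L` splits at every prime of `S`, is inert at every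
prime of `T`, and has `3 ∤ h_L`. "Split"/"inert" are spelled in the tree's currency (as in
`Literature.NumberTheory.EllipticCurves.SatisfiesHeegnerHypothesis` and the cell bsd-ssimc's
`BSTWScope.IsAuxiliaryField`): `p ∤ d_L` and the number of primes of `𝓞 L` over `p` is `2`, resp. `1`.

Why it is wanted (route `SignedLowerHalves` of `BirchSwinnertonDyer`, item stmt-BirchSwinnertonDyer-19000,
cell bsd-ssimc): at `p = 3` it discharges CLASS-WIDE the auxiliary-field rider (α) «an S2-field `L` with
`p ∤ h_L`» of the cell's verified reading of Burungale–Skinner–Tian–Wan Thm. 1.3 — the analogue at a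
prime `ℓ ≥ 5` is NOT in print (Wiles, JLMS 92 (2015) Thm. 0.0.1 and Beckwith, Res. Math. Sci. 2017
exclude split primes `≡ −1 (mod ℓ)` and say nothing at `2`; Beckwith–Raum–Richter arXiv:2305.19272
Thm. 1 has no inert condition and nothing at `2`; Bruinier 1999 excludes `ℓ` itself).

-- TODO(general form): the printed statement is the AVERAGE (`= 2` imaginary, `= 4/3` real) over the
-- family ordered by `|d_L|`, for any acceptable collection of local specifications (Thm. 3 for orders);
-- only the existence consequence for unramified split/inert conditions is typed here.

## Mathlib / tree search
Mathlib (pin v4.32.0) has `NumberField.classNumber`, `NumberField.discr`, `Ideal.primesOver`, but no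
Davenport–Heilbronn theory (searched `Davenport`, `cubic form`, `3-torsion`, `torsion classGroup`).
Tree: `Literature/NumberTheory/QuadraticFields/ImaginaryQuadraticPrescribedSplitting.lean` gives
prescribed SPLITTING (Dirichlet + reciprocity) without class-number control; nothing on `ℓ ∤ h` with
local conditions (searched `classNumber`, `not_dvd_classNumber`, `Heilbronn`, `Bhargava`).

## References
* [BhargavaVarma2016] M. Bhargava, I. Varma, Proc. LMS (3) 112 (2016) 235–266, doi:10.1112/plms/pdv062,
  Cor. 4 (a) (p. 237), Thm. 3 (p. 236–237); arXiv:1401.5875 p. 3.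
* H. Davenport, H. Heilbronn, *On the density of discriminants of cubic fields II*, Proc. Roy. Soc.
  London A 322 (1971) 405–420, Thm. 3 (cited through [BhargavaVarma2016] Thm. 1).
-/

namespace Literature.NumberTheory.QuadraticFields

open NumberField

/-- **Bhargava–Varma 2016, Cor. 4 (a) — existence consequence.** For disjoint finite sets `S`, `T`
of primes there is an imaginary quadratic field `L` (`[L : ℚ] = 2`, `d_L < 0`) in which every
`p ∈ S` is unramified and split (`p ∤ d_L`, two primes of `𝓞 L` above `p`), every `q ∈ T` is
unramified and inert (`q ∤ d_L`, one prime above `q`), and whose class number is prime to `3`.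
Printed: "Suppose one restricts to just those quadratic fields satisfying any specified set of local
conditions at any finite set of primes. Then … (a) The average number of 3-torsion elements in the
class groups of such imaginary quadratic fields is 2" — and `#Cl(L)[3] ∈ {1, 3, 9, …}` over an
infinite family with average `2` forces `#Cl(L)[3] = 1`, i.e. `3 ∤ h_L`, for infinitely many members.
Cite-only named fact; nothing asserted. [cite: BhargavaVarma2016, Cor. 4 (a) (p. 237)] -/
def bhargavaVarma2016_exists_imaginaryQuadratic_split_inert_three_not_dvd_classNumber : Prop :=
  ∀ (S T : Finset ℕ), (∀ p ∈ S, p.Prime) → (∀ q ∈ T, q.Prime) → Disjoint S T →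
    ∃ (L : Type) (_ : Field L) (_ : NumberField L),
      Module.finrank ℚ L = 2 ∧ NumberField.discr L < 0 ∧
      (∀ p ∈ S, ¬ (p : ℤ) ∣ NumberField.discr L ∧
        ((Ideal.span {(p : ℤ)}).primesOver (𝓞 L)).ncard = 2) ∧
      (∀ q ∈ T, ¬ (q : ℤ) ∣ NumberField.discr L ∧
        ((Ideal.span {(q : ℤ)}).primesOver (𝓞 L)).ncard = 1) ∧
      ¬ 3 ∣ NumberField.classNumber L

end Literature.NumberTheory.QuadraticFields
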